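import Summits.SmoothPoincare4.SmoothPoincare4.Theorems.CylinderEntropyCylinderRungTwoTiltExcess
import Summits.SmoothPoincare4.SmoothPoincare4.Theorems.CylinderEntropyCylinderRungTwoAreaDissipation
import Literature.Geometry.Riemannian.EmbeddedSubmanifoldHausdorff
import HarnessLib

/-!
# Route `CylinderEntropy`, crux `CylinderRungTwo` (stmt-SmoothPoincare4-7631), line `killing-flux`:
# TILT-EXCESS VANISHING along an almost-stationary slab-confined sequence
# (registered helper `helper_tiltExcessVanishing`, the horizontality step of `stub_areaQuantization`)

For a sequence of closed embedded cross-sections `ι_k : M⁴ → N = S⁴ × ℝ = {z ∈ ℝ⁶ | ∑_{i<5} zᵢ² = 1}`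
with smooth unit normals `ν_k` tangent to `N`, heights `|z₅| ≤ B` on `ι_k(M)`, Willmore-type
energies `W_k = ∫ H_k² d(ι_k^* μH⁴) → 0` and areas `μH⁴(ι_k(M)) → A < ∞`, the TILT EXCESS vanishes:

  `∫_M (1 - (ν_k)₅²) d(ι_k^* μH⁴) → 0`.

This is pure bookkeeping around the landed single-slice decay estimate
`tiltExcess_le_sqrt_of_abs_height_le` (`…TiltExcess.lean`):
`∫_M (1 - ν₅²) dμ_g ≤ B √(μ_g(M) ∫_M H² dμ_g)`, `μ_g` the Riemannian measure of `g = f^*δ`.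

* `smul_comap_hausdorffMeasure_eq_riemannianMeasure` — for an injective immersion `f` (a closed
  measurable embedding) the pull-back `f^* μH⁴ = Measure.comap f μH⁴` is the area measure up to
  Mathlib's normalisation `μHE⁴ = c • μH⁴` (`c ≠ 0`): `c • f^* μH⁴ = μ_g`
  (`riemannianMeasure_induced_apply`, `MeasurableEmbedding.comap_apply`);
* `one_sub_sq_apply_five_nonneg` — `0 ≤ 1 - ν₅²` (`|ν₅| ≤ ‖ν‖ = 1`);
* `lintegral_ofReal_le_of_integral_le_sqrt` — abstract conversion of a real estimate
  `∫ T dμ ≤ B √(μ(univ) ∫ H² dμ)` with `μ = c • P` into the `ℝ≥0∞` bound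
  `∫⁻ T dP ≤ c⁻¹ · ofReal (B √((c P(univ)) (c ∫⁻ H² dP)))`;
* `lintegral_tiltExcess_comap_le` — the single-slice bound for `P = f^* μH⁴`;
* `tendsto_zero_of_le_inv_mul_ofReal_sqrt` — the abstract squeeze (`W_k → 0`, areas `→ A < ∞`);
* `tendsto_lintegral_tiltExcess_comap` — the statement with implicit binders;
* `helper_tiltExcessVanishing` — the registered helper, verbatim.

No case distinction on `M = ∅` or on the sign of `B` is needed: `ENNReal.ofReal` clamps at `0`.
Everything here is PROVED (no `sorry`, no new definitions, no named facts).

References: R. S. Hamilton, Comm. Anal. Geom. 1 (1993) 127–137, §4 (first variation on slices of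
`S⁴ × ℝ`); H. Federer, *Geometric Measure Theory* (1969), 3.2.3 and 3.2.46 (area formula,
Riemannian measure = Hausdorff measure).
-/

-- the prescribed namespace `Summit.SmoothPoincare4.SmoothPoincare4.…` repeats `SmoothPoincare4`
set_option linter.dupNamespace false

noncomputable section

open Set Function Filter MeasureTheory
open scoped Manifold ContDiff ENNReal NNReal Topology BigOperators RealInnerProductSpace

namespace Summit.SmoothPoincare4.SmoothPoincare4.Cruxes.CylinderRungTwo.KillingFlux

open Literature.Geometry.Riemannian Literature.Geometry.Lorentzian
  Literature.Geometry.Lorentzian.PseudoRiemannianMetric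

/-! ## Abstract measure-theoretic bookkeeping -/

section Abstract

variable {X : Type*} [MeasurableSpace X]

/-- **From a real Cauchy–Schwarz-type estimate to an `ℝ≥0∞` bound for the rescaled measure.**
If `μ = c • P` (`c ≠ 0` finite), `T ≥ 0` is `μ`-integrable, `H` is a.e. strongly measurable and
`∫ T dμ ≤ B √(μ(univ) · ∫ H² dμ)`, then
`∫⁻ T dP ≤ c⁻¹ · ofReal (B √((c · P(univ)) · (c · ∫⁻ H² dP)))` (all conversions between Bochner
and lower Lebesgue integrals of non-negative functions). [folklore] -/
theorem lintegral_ofReal_le_of_integral_le_sqrt {μ P : Measure X} {c : ℝ≥0} (hc0 : c ≠ 0)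
    (hμ : (c : ℝ≥0∞) • P = μ) {T H : X → ℝ} (hTi : Integrable T μ) (hTnn : ∀ x, 0 ≤ T x)
    (hH : AEStronglyMeasurable H μ) {B : ℝ}
    (hle : ∫ x, T x ∂μ ≤ B * Real.sqrt ((μ univ).toReal * ∫ x, H x ^ 2 ∂μ)) :
    ∫⁻ x, ENNReal.ofReal (T x) ∂P ≤
      (c : ℝ≥0∞)⁻¹ * ENNReal.ofReal (B * Real.sqrt (((c : ℝ≥0∞) * P univ).toReal *
        ((c : ℝ≥0∞) * ∫⁻ x, ENNReal.ofReal (H x ^ 2) ∂P).toReal)) := by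
  have h1 : ∫⁻ x, ENNReal.ofReal (T x) ∂μ = (c : ℝ≥0∞) * ∫⁻ x, ENNReal.ofReal (T x) ∂P := by
    rw [← hμ, lintegral_smul_measure, smul_eq_mul]
  have h2 : ∫⁻ x, ENNReal.ofReal (H x ^ 2) ∂μ = (c : ℝ≥0∞) * ∫⁻ x, ENNReal.ofReal (H x ^ 2) ∂P := by
    rw [← hμ, lintegral_smul_measure, smul_eq_mul]
  have h3 : μ univ = (c : ℝ≥0∞) * P univ := by
    rw [← hμ, Measure.smul_apply, smul_eq_mul]
  have h4 : ∫ x, H x ^ 2 ∂μ = ((c : ℝ≥0∞) * ∫⁻ x, ENNReal.ofReal (H x ^ 2) ∂P).toReal := by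
    rw [← h2]
    exact integral_eq_lintegral_of_nonneg_ae (Eventually.of_forall fun x => sq_nonneg (H x))
      (hH.pow 2)
  have h5 : ENNReal.ofReal (∫ x, T x ∂μ) = (c : ℝ≥0∞) * ∫⁻ x, ENNReal.ofReal (T x) ∂P := by
    rw [← h1]
    exact ofReal_integral_eq_lintegral_ofReal hTi (Eventually.of_forall hTnn)
  have hcc : (c : ℝ≥0∞)⁻¹ * (c : ℝ≥0∞) = 1 :=
    ENNReal.inv_mul_cancel (ENNReal.coe_ne_zero.2 hc0) ENNReal.coe_ne_top
  calc ∫⁻ x, ENNReal.ofReal (T x) ∂P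
      = (c : ℝ≥0∞)⁻¹ * ((c : ℝ≥0∞) * ∫⁻ x, ENNReal.ofReal (T x) ∂P) := by
        rw [← mul_assoc, hcc, one_mul]
    _ = (c : ℝ≥0∞)⁻¹ * ENNReal.ofReal (∫ x, T x ∂μ) := by rw [h5]
    _ ≤ (c : ℝ≥0∞)⁻¹ * ENNReal.ofReal (B * Real.sqrt ((μ univ).toReal * ∫ x, H x ^ 2 ∂μ)) :=
        mul_le_mul_right (ENNReal.ofReal_le_ofReal hle) _
    _ = (c : ℝ≥0∞)⁻¹ * ENNReal.ofReal (B * Real.sqrt (((c : ℝ≥0∞) * P univ).toReal *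
          ((c : ℝ≥0∞) * ∫⁻ x, ENNReal.ofReal (H x ^ 2) ∂P).toReal)) := by rw [h3, h4]

/-- **The abstract squeeze.** If `0 ≤ T_k ≤ c⁻¹ · ofReal (B √((c a_k) (c W_k)))` in `ℝ≥0∞` with
`c ≠ 0` finite, `W_k → 0` and `a_k → A < ∞`, then `T_k → 0` (continuity of `toReal` at finite
points, of `√` and of `ofReal`). [folklore] -/
theorem tendsto_zero_of_le_inv_mul_ofReal_sqrt {T W a : ℕ → ℝ≥0∞} {c : ℝ≥0} (hc0 : c ≠ 0) {B : ℝ}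
    (hle : ∀ k, T k ≤ (c : ℝ≥0∞)⁻¹ * ENNReal.ofReal (B * Real.sqrt (((c : ℝ≥0∞) * a k).toReal *
      ((c : ℝ≥0∞) * W k).toReal)))
    (hW : Tendsto W atTop (𝓝 0)) {A : ℝ≥0∞} (hA : A < ⊤) (ha : Tendsto a atTop (𝓝 A)) :
    Tendsto T atTop (𝓝 0) := by
  have hW' : Tendsto (fun k => ((c : ℝ≥0∞) * W k).toReal) atTop (𝓝 0) := by
    have h1 : Tendsto (fun k => (c : ℝ≥0∞) * W k) atTop (𝓝 ((c : ℝ≥0∞) * 0)) :=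
      ENNReal.Tendsto.const_mul hW (Or.inr ENNReal.coe_ne_top)
    rw [mul_zero] at h1
    have h2 := (ENNReal.tendsto_toReal ENNReal.zero_ne_top).comp h1
    rwa [ENNReal.toReal_zero] at h2
  have ha' : Tendsto (fun k => ((c : ℝ≥0∞) * a k).toReal) atTop (𝓝 (((c : ℝ≥0∞) * A).toReal)) :=
    (ENNReal.tendsto_toReal (ENNReal.mul_ne_top ENNReal.coe_ne_top hA.ne)).comp
      (ENNReal.Tendsto.const_mul ha (Or.inr ENNReal.coe_ne_top))
  have hu : Tendsto (fun k => (c : ℝ≥0∞)⁻¹ * ENNReal.ofReal (B * Real.sqrt (((c : ℝ≥0∞) * a k).toReal *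
      ((c : ℝ≥0∞) * W k).toReal))) atTop (𝓝 0) := by
    have h1 : Tendsto (fun k => B * Real.sqrt (((c : ℝ≥0∞) * a k).toReal * ((c : ℝ≥0∞) * W k).toReal))
        atTop (𝓝 (B * Real.sqrt (((c : ℝ≥0∞) * A).toReal * 0))) :=
      (ha'.mul hW').sqrt.const_mul B
    rw [mul_zero, Real.sqrt_zero, mul_zero] at h1
    have h2 := ENNReal.Tendsto.const_mul (a := (c : ℝ≥0∞)⁻¹) (ENNReal.tendsto_ofReal h1)
      (Or.inr (ENNReal.inv_ne_top.2 (ENNReal.coe_ne_zero.2 hc0)))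
    rwa [ENNReal.ofReal_zero, mul_zero] at h2
  exact tendsto_of_tendsto_of_tendsto_of_le_of_le tendsto_const_nhds hu (fun _ => zero_le) hle

end Abstract

/-! ## The pull-back Hausdorff measure of an embedded cross-section and the single-slice bound -/

section Slice

variable {M : Type*} [TopologicalSpace M] [ChartedSpace (EuclideanSpace ℝ (Fin 4)) M]
  [IsManifold (𝓡 4) ∞ M] [CompactSpace M] [T2Space M] [MeasurableSpace M] [BorelSpace M]

/-- **The pull-back Hausdorff measure is the area measure, up to normalisation**: for an injective
immersion `f : M⁴ → ℝ⁶` of a closed manifold (a closed, hence measurable, embedding) and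
`μHE⁴ = c • μH⁴`, `c • Measure.comap f μH⁴ = μ_{f^*δ}` (area formula
`riemannianMeasure_induced_apply`: `μ_{f^*δ}(S) = μHE⁴(f(S))`, and `(comap f μH⁴)(S) = μH⁴(f(S))`).
[cite: Federer1969, 3.2.3 and 3.2.46] -/
theorem smul_comap_hausdorffMeasure_eq_riemannianMeasure {f : M → EuclideanSpace ℝ (Fin 6)}
    (hf : (euclideanMetric (EuclideanSpace ℝ (Fin 6))).IsSpacelikeImmersion (𝓡 4) f)
    (hinj : Injective f) {c : ℝ≥0}
    (hc : (μHE[4] : Measure (EuclideanSpace ℝ (Fin 6))) =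
      c • (μH[4] : Measure (EuclideanSpace ℝ (Fin 6)))) :
    (c : ℝ≥0∞) • Measure.comap f (μH[4] : Measure (EuclideanSpace ℝ (Fin 6))) =
      riemannianMeasure ((euclideanMetric (EuclideanSpace ℝ (Fin 6))).inducedRiemannianMetric f
        contMDiff_pullbackBilin_holds hf) := by
  have hme : MeasurableEmbedding f :=
    (hf.contMDiff.continuous.isClosedEmbedding hinj).measurableEmbedding
  refine Measure.ext fun s hs => ?_
  rw [Measure.smul_apply, smul_eq_mul, hme.comap_apply, riemannianMeasure_induced_apply hf hinj hs,
    hc, Measure.smul_apply, ENNReal.smul_def, smul_eq_mul]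

omit [IsManifold (𝓡 4) ∞ M] [CompactSpace M] [T2Space M] [MeasurableSpace M] [BorelSpace M] in
/-- `0 ≤ 1 - ν₅²` for a unit normal field `ν` (`|ν₅| ≤ ‖ν‖ = 1`). [folklore] -/
theorem one_sub_sq_apply_five_nonneg {f νf : M → EuclideanSpace ℝ (Fin 6)}
    (hun : (euclideanMetric (EuclideanSpace ℝ (Fin 6))).IsUnitNormal (𝓡 4) f νf 1) (w : M) :
    0 ≤ 1 - νf w 5 ^ 2 := by
  have hνunit : ‖νf w‖ = 1 := by
    have h : ⟪νf w, νf w⟫ = (1 : ℝ) := by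
      have := hun.val_self w
      rwa [euclideanMetric_apply] at this
    rw [real_inner_self_eq_norm_sq] at h
    nlinarith [norm_nonneg (νf w)]
  have hν5 : |νf w 5| ≤ 1 := by
    have h1 : |νf w 5| = ‖νf w 5‖ := (Real.norm_eq_abs _).symm
    rw [h1, ← hνunit]
    exact PiLp.norm_apply_le (νf w) 5
  have h2 : νf w 5 ^ 2 ≤ 1 := (sq_le_one_iff_abs_le_one _).2 hν5
  linarith

/-- **Single-slice tilt-excess bound against the pull-back Hausdorff measure**: for a closed
embedded cross-section `f : M⁴ → N` with smooth unit normal `ν` tangent to `N`, `|z₅| ≤ B` on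
`f(M)` and `μHE⁴ = c • μH⁴`,
`∫⁻ (1 - ν₅²) d(f^*μH⁴) ≤ c⁻¹ ofReal (B √((c μH⁴(f(M))) · (c ∫⁻ H² d(f^*μH⁴))))` — the landed decay
estimate `tiltExcess_le_sqrt_of_abs_height_le` transported through `c • f^*μH⁴ = μ_g`.
[cite: Hamilton1993, §4] -/
theorem lintegral_tiltExcess_comap_le {f νf : M → EuclideanSpace ℝ (Fin 6)}
    (hf : (euclideanMetric (EuclideanSpace ℝ (Fin 6))).IsSpacelikeImmersion (𝓡 4) f)
    (hinj : Injective f)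
    (hν : ContMDiff (𝓡 4) 𝓘(ℝ, EuclideanSpace ℝ (Fin 6)) ∞ νf)
    (hun : (euclideanMetric (EuclideanSpace ℝ (Fin 6))).IsUnitNormal (𝓡 4) f νf 1)
    (hN : ∀ x, ∑ i : Fin 5, f x (Fin.castSucc i) ^ 2 = 1)
    (hνN : ∀ x, ∑ i : Fin 5, νf x (Fin.castSucc i) * f x (Fin.castSucc i) = 0)
    {B : ℝ} (hB : ∀ x, |f x 5| ≤ B) {c : ℝ≥0} (hc0 : c ≠ 0)
    (hc : (μHE[4] : Measure (EuclideanSpace ℝ (Fin 6))) =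
      c • (μH[4] : Measure (EuclideanSpace ℝ (Fin 6)))) :
    ∫⁻ x, ENNReal.ofReal (1 - νf x 5 ^ 2) ∂(Measure.comap f (μH[4] : Measure (EuclideanSpace ℝ (Fin 6)))) ≤
      (c : ℝ≥0∞)⁻¹ * ENNReal.ofReal (B * Real.sqrt
        (((c : ℝ≥0∞) * μH[4] (range f)).toReal *
          ((c : ℝ≥0∞) * ∫⁻ x, ENNReal.ofReal
            ((euclideanMetric (EuclideanSpace ℝ (Fin 6))).meanCurvature f
              contMDiff_pullbackBilin_holds hf νf x ^ 2)
            ∂(Measure.comap f (μH[4] : Measure (EuclideanSpace ℝ (Fin 6))))).toReal)) := by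
  have hme : MeasurableEmbedding f :=
    (hf.contMDiff.continuous.isClosedEmbedding hinj).measurableEmbedding
  have huniv : (Measure.comap f (μH[4] : Measure (EuclideanSpace ℝ (Fin 6)))) univ =
      μH[4] (range f) := by
    rw [hme.comap_apply, image_univ]
  rw [← huniv]
  have h5 : Continuous fun z : EuclideanSpace ℝ (Fin 6) => z 5 :=
    (EuclideanSpace.proj (5 : Fin 6) : EuclideanSpace ℝ (Fin 6) →L[ℝ] ℝ).continuous
  exact lintegral_ofReal_le_of_integral_le_sqrt hc0
    (smul_comap_hausdorffMeasure_eq_riemannianMeasure hf hinj hc)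
    (integrable_of_continuous (h := (euclideanMetric (EuclideanSpace ℝ (Fin 6))).inducedRiemannianMetric f
        contMDiff_pullbackBilin_holds hf) (continuous_const.sub ((h5.comp hν.continuous).pow 2)))
    (one_sub_sq_apply_five_nonneg hun)
    (continuous_meanCurvature_euclidean hf hν).aestronglyMeasurable
    (tiltExcess_le_sqrt_of_abs_height_le hf hν hun hN hνN hB)

/-- **Tilt-excess vanishing along an almost-stationary slab-confined sequence.** For closed
embedded cross-sections `ι_k : M⁴ → N = S⁴ × ℝ` with smooth unit normals `ν_k` tangent to `N`,
heights `|z₅| ≤ B`, `∫ H_k² d(ι_k^*μH⁴) → 0` and `μH⁴(ι_k(M)) → A < ∞`: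
`∫ (1 - (ν_k)₅²) d(ι_k^*μH⁴) → 0` (single-slice bound `lintegral_tiltExcess_comap_le` and the
squeeze `tendsto_zero_of_le_inv_mul_ofReal_sqrt`). [cite: Hamilton1993, §4] -/
theorem tendsto_lintegral_tiltExcess_comap {ι ν : ℕ → M → EuclideanSpace ℝ (Fin 6)}
    (hinj : ∀ k, Injective (ι k))
    (himm : ∀ k, (euclideanMetric (EuclideanSpace ℝ (Fin 6))).IsSpacelikeImmersion (𝓡 4) (ι k))
    (hν : ∀ k, ContMDiff (𝓡 4) 𝓘(ℝ, EuclideanSpace ℝ (Fin 6)) ∞ (ν k))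
    (hun : ∀ k, (euclideanMetric (EuclideanSpace ℝ (Fin 6))).IsUnitNormal (𝓡 4) (ι k) (ν k) 1)
    (hN : ∀ k x, ∑ i : Fin 5, ι k x (Fin.castSucc i) ^ 2 = 1)
    (hνN : ∀ k x, ∑ i : Fin 5, ν k x (Fin.castSucc i) * ι k x (Fin.castSucc i) = 0)
    {B : ℝ} (hB : ∀ k x, |ι k x 5| ≤ B)
    (hW : Tendsto (fun k => ∫⁻ x, ENNReal.ofReal
        ((euclideanMetric (EuclideanSpace ℝ (Fin 6))).meanCurvature (ι k)
          contMDiff_pullbackBilin_holds (himm k) (ν k) x ^ 2)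
        ∂(Measure.comap (ι k) (μH[4] : Measure (EuclideanSpace ℝ (Fin 6))))) atTop (𝓝 0))
    {A : ℝ≥0∞} (hA : A < ⊤) (hAr : Tendsto (fun k => μH[4] (range (ι k))) atTop (𝓝 A)) :
    Tendsto (fun k => ∫⁻ x, ENNReal.ofReal (1 - ν k x 5 ^ 2)
      ∂(Measure.comap (ι k) (μH[4] : Measure (EuclideanSpace ℝ (Fin 6))))) atTop (𝓝 0) := by
  -- Mathlib's normalisation `μHE⁴ = c • μH⁴`, `c ≠ 0`
  obtain ⟨c, hc0, hc⟩ : ∃ c : ℝ≥0, c ≠ 0 ∧ (μHE[4] : Measure (EuclideanSpace ℝ (Fin 6))) =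
      c • (μH[4] : Measure (EuclideanSpace ℝ (Fin 6))) :=
    ⟨_, Measure.addHaarScalarFactor_volume_hausdorffMeasure_ne_zero 4,
      Measure.euclideanHausdorffMeasure_def (X := EuclideanSpace ℝ (Fin 6)) 4⟩
  exact tendsto_zero_of_le_inv_mul_ofReal_sqrt hc0
    (fun k => lintegral_tiltExcess_comap_le (himm k) (hinj k) (hν k) (hun k) (hN k) (hνN k) (hB k)
      hc0 hc) hW hA hAr

end Slice

/-- **Registered helper `helper_tiltExcessVanishing` of line `killing-flux` (horizontality step of
`stub_areaQuantization`).** For a sequence of closed smooth embedded cross-sections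
`ι_k : M⁴ → N = S⁴ × ℝ ⊂ ℝ⁶` with smooth unit normals `ν_k` tangent to `N`, heights `|z₅| ≤ B`,
Willmore-type energies `∫ H_k² d(ι_k^*μH⁴) → 0` and areas `μH⁴(ι_k(M)) → A < ∞`, the tilt excess
vanishes: `∫ (1 - (ν_k)₅²) d(ι_k^*μH⁴) → 0` (`tendsto_lintegral_tiltExcess_comap`; the embeddings
are injective, `Manifold.IsSmoothEmbedding.isEmbedding`). [cite: Hamilton1993, §4] -/
theorem helper_tiltExcessVanishing : ∀ (M : Type) [TopologicalSpace M] [T2Space M] [SecondCountableTopology M] [ChartedSpace (EuclideanSpace ℝ (Fin 4)) M] [IsManifold (𝓡 4) ∞ M] [CompactSpace M] [MeasurableSpace M] [BorelSpace M] (ι : ℕ → M → EuclideanSpace ℝ (Fin 6)) (ν : ℕ → M → EuclideanSpace ℝ (Fin 6)), (∀ k, Manifold.IsSmoothEmbedding (𝓡 4) (𝓡 6) ∞ (ι k)) → (∀ k x, ∑ i : Fin 5, ι k x (Fin.castSucc i) ^ 2 = 1) → ∀ himm : ∀ k, (Literature.Geometry.Riemannian.euclideanMetric (EuclideanSpace ℝ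 (Fin 6))).IsSpacelikeImmersion (𝓡 4) (ι k), (∀ k, (Literature.Geometry.Riemannian.euclideanMetric (EuclideanSpace ℝ (Fin 6))).IsUnitNormal (𝓡 4) (ι k) (ν k) 1) → (∀ k x, ∑ i : Fin 5, ν k x (Fin.castSucc i) * ι k x (Fin.castSucc i) = 0) → (∀ k, ContMDiff (𝓡 4) (𝓡 6) ∞ (ν k)) → ∀ B : ℝ, (∀ k x, |ι k x 5| ≤ B) → Filter.Tendsto (fun k => ∫⁻ x, ENNReal.ofReal ((Literature.Geometry.Riemannian.euclideanMetric (EuclideanSpace ℝ (Fin 6))).meanCurvature (ι k) Literature.Geometry.Lorentzian.PseudoRiemannianMetric.contMDiff_pullbackBilin_holds (himm k) (ν k) x ^ 2) ∂(Measure.comap (ι k) (μH[4] : Measure (EuclideanSpace ℝ (Fin 6))))) Filter.atTop (𝓝 0) → ∀ A : ℝ≥0∞, A < ⊤ → Filter.Tendsto (fun k => μH[4] (Set.range (ι k))) Filter.atTop (𝓝 A) → Filter.Tendsto (fun k => ∫⁻ x, ENNReal.ofReal (1 - ν k x 5 ^ 2) ∂(Measure.comap (ι k) (μH[4] : Measure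 (EuclideanSpace ℝ (Fin 6))))) Filter.atTop (𝓝 0) :=
  fun _ _ _ _ _ _ _ _ _ _ _ hemb hN himm hun hνN hνs _ hB hW _ hA hAr =>
    tendsto_lintegral_tiltExcess_comap (fun k => (hemb k).isEmbedding.injective) himm hνs hun hN hνN
      hB hW hA hAr

end Summit.SmoothPoincare4.SmoothPoincare4.Cruxes.CylinderRungTwo.KillingFlux

end
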